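import Mathlib
import HarnessLib

/-!
# `PerpetualPump.CircuitTrace` (crux stmt-NavierStokesRegularity-1836), line `tilted-trace-gronwall`:
# stub S6 `stub_traceEndgame` — the trace endgame

Helper file (lands `--supports stmt-NavierStokesRegularity-1836`) proving the registered stub
`stub_traceEndgame` of the lead's skeleton verbatim. PURE REAL ANALYSIS, no ODE and no circuit objects:
functions `X_{i,n} : ℝ → ℝ` (`i ∈ Fin m`, `n ∈ ℤ`) whose tilted low-block energies
`L^β_N(t) = Σ_{k=0}^{N} Σ_i lam^{2βk} X_{i,k}(t)²` (tilt `β > 1/5`) obey the forward Grönwall inequality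
`e^{-Γ lam^{4N/5}(t₂-t₁)} L^β_N(t₁) ≤ L^β_N(t₂)` on `(0,T)`, which have terminal traces `τ_{i,n}` at `T⁻`
that are `ℓ³`-bounded in critical units (`Σ (lam^{n/5}|τ_{i,n}|)³ ≤ M` on finite sets), admit NO paced
`δ`-hot fronts `(n,i,t)` (`lam^{4n/5}(T-t) ≤ R`, `δ ≤ lam^{n/5}|X_{i,n}(t)|`) along `n → ∞`.

Proof (Toeplitz endgame). Put `γ = 2β - 2/5 > 0`, `σ_{i,k} = lam^{k/5}|τ_{i,k}|`, `c₀ = e^{-Γ⁺R⁺}`.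
* `traceEndgame_front_bound`: at a front, Grönwall from `t` to `t₂ ∈ [t,T)` costs at most the factor
  `c₀` (the front is within `R` units of its own clock), and the single term `k = n` gives
  `L^β_n(t₂) ≥ c₀ δ² lam^{γn}`; letting `t₂ ↑ T` (finite sums pass to the limit),
  `Σ_{k≤n} Σ_i lam^{2βk} τ_{i,k}² ≥ c₀ δ² lam^{γn}`, i.e. `Σ_{k≤n} Σ_i lam^{γk} σ_{i,k}² ≥ c₀ δ² lam^{γn}`.
* `traceEndgame_eventually_small`: the `ℓ³` bound makes `{k | ∃ i, σ_{i,k} ≥ ε}` finite (counting).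
* `traceEndgame_discounted_small`: hence the discounted sums `Σ_{k≤n} Σ_i lam^{γk} σ_{i,k}²` are
  eventually `< c · lam^{γn}` for every `c > 0` (head: a constant, `lam^{γn} → ∞`; tail: `σ < ε`
  and the geometric bound `(1 - lam^{-γ}) Σ_{k≤n} lam^{γk} ≤ lam^{γn}`, `traceEndgame_geom`).
Taking `c = c₀ δ²` and a front at a scale beyond the threshold is the contradiction. [folklore]
-/

noncomputable section

-- the summit's doubled path component `NavierStokesRegularity.NavierStokesRegularity` is the tree convention
set_option linter.dupNamespace false

namespace Summit.NavierStokesRegularity.NavierStokesRegularity.Theorems.PerpetualPumpCircuitTrace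

open Finset Real Set Filter Topology

/-! ## Bookkeeping lemmas -/

/-- Tilt bookkeeping: `lam^{2βk} x² = lam^{(2β-2/5)k} · (lam^{k/5}|x|)²` for `lam > 0`. -/
theorem traceEndgame_tilt_split {lam : ℝ} (hlam : 0 < lam) (β k x : ℝ) :
    lam ^ (2 * β * k) * x ^ 2
      = lam ^ ((2 * β - 2 / 5) * k) * (lam ^ ((1 / 5 : ℝ) * k) * |x|) ^ 2 := by
  have h1 : (lam ^ ((1 / 5 : ℝ) * k)) ^ 2 = lam ^ ((2 / 5 : ℝ) * k) := by
    rw [pow_two, ← Real.rpow_add hlam]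
    congr 1
    ring
  have h2 : lam ^ (2 * β * k) = lam ^ ((2 * β - 2 / 5) * k) * lam ^ ((2 / 5 : ℝ) * k) := by
    rw [← Real.rpow_add hlam]
    congr 1
    ring
  rw [mul_pow, sq_abs, h1, h2]
  ring

/-- Geometric bookkeeping (telescoping, no sign condition on `γ`):
`(1 - lam^{-γ}) · Σ_{k ≤ n} lam^{γk} ≤ lam^{γn}` for `lam > 0`. -/
theorem traceEndgame_geom {lam : ℝ} (hlam : 0 < lam) (γ : ℝ) (n : ℕ) :
    (1 - lam ^ (-γ)) * ∑ k ∈ Finset.range (n + 1), lam ^ (γ * k) ≤ lam ^ (γ * n) := by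
  induction n with
  | zero =>
    rw [zero_add, Finset.sum_range_one, Nat.cast_zero, mul_zero, Real.rpow_zero, mul_one]
    linarith [(Real.rpow_pos_of_pos hlam (-γ)).le]
  | succ n ih =>
    rw [Finset.sum_range_succ, mul_add]
    have h : lam ^ (-γ) * lam ^ (γ * ((n + 1 : ℕ) : ℝ)) = lam ^ (γ * (n : ℝ)) := by
      rw [← Real.rpow_add hlam]
      congr 1
      push_cast
      ring
    linarith [h]

/-! ## `ℓ³` counting -/

/-- `ℓ³`-COUNTING: a nonnegative family `σ` on `Fin m × ℤ` all of whose finite sums of cubes are `≤ M`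
is eventually `< ε` along `ℕ`, for every `ε > 0`: the set `{k | ∃ i, ε ≤ σ_{i,k}}` is finite, since `N`
of its points already carry `N ε³` of the budget `M`. -/
theorem traceEndgame_eventually_small {m : ℕ} {M : ℝ} {σ : Fin m → ℤ → ℝ}
    (hσ : ∀ i k, 0 ≤ σ i k) (hM : ∀ s : Finset ℤ, ∑ n ∈ s, ∑ i : Fin m, σ i n ^ 3 ≤ M)
    {ε : ℝ} (hε : 0 < ε) :
    ∃ k₀ : ℕ, ∀ k : ℕ, k₀ < k → ∀ i : Fin m, σ i k < ε := by
  have hfin : {k : ℕ | ∃ i : Fin m, ε ≤ σ i k}.Finite := by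
    by_contra hinf
    have hinf' : {k : ℕ | ∃ i : Fin m, ε ≤ σ i k}.Infinite := hinf
    obtain ⟨N, hN⟩ := exists_nat_gt (M / ε ^ 3)
    obtain ⟨s, hs, hcard⟩ := hinf'.exists_subset_card_eq N
    have h1 : (N : ℝ) * ε ^ 3 ≤ ∑ k ∈ s, ∑ i : Fin m, σ i k ^ 3 := by
      have h := Finset.card_nsmul_le_sum s (fun k : ℕ => ∑ i : Fin m, σ i k ^ 3) (ε ^ 3) ?_
      · rw [hcard, nsmul_eq_mul] at h
        exact h
      intro k hk
      obtain ⟨i, hi⟩ := hs (Finset.mem_coe.mpr hk)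
      calc ε ^ 3 ≤ σ i k ^ 3 := pow_le_pow_left₀ hε.le hi 3
        _ ≤ ∑ j : Fin m, σ j k ^ 3 :=
          Finset.single_le_sum (f := fun j => σ j k ^ 3) (fun j _ => pow_nonneg (hσ j k) 3)
            (Finset.mem_univ i)
    have h2 : ∑ k ∈ s, ∑ i : Fin m, σ i k ^ 3 ≤ M := by
      simpa [Finset.sum_map] using hM (s.map Nat.castEmbedding)
    have h3 : M < N * ε ^ 3 := (div_lt_iff₀ (by positivity)).mp hN
    linarith
  obtain ⟨k₀, hk₀⟩ := hfin.bddAbove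
  refine ⟨k₀, fun k hk i => ?_⟩
  by_contra hge
  have hmem : k ∈ {k : ℕ | ∃ i : Fin m, ε ≤ σ i k} := ⟨i, not_lt.mp hge⟩
  exact absurd (hk₀ hmem) (not_le.mpr hk)

/-- TOEPLITZ STEP: for a nonnegative family `σ` on `Fin m × ℤ` with all finite sums of cubes `≤ M`, and
`lam > 1`, `γ > 0`, the discounted sums `Σ_{k ≤ n} Σ_i lam^{γk} σ_{i,k}²` are eventually `< c · lam^{γn}`
for every `c > 0` (head `k ≤ k₀`: a constant, beaten by `lam^{γn} → ∞`; tail `k > k₀`: `σ < ε` and the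
geometric bound `traceEndgame_geom`). -/
theorem traceEndgame_discounted_small {lam : ℝ} (hlam : 1 < lam) {γ : ℝ} (hγ : 0 < γ) {m : ℕ}
    {M : ℝ} {σ : Fin m → ℤ → ℝ} (hσ : ∀ i k, 0 ≤ σ i k)
    (hM : ∀ s : Finset ℤ, ∑ n ∈ s, ∑ i : Fin m, σ i n ^ 3 ≤ M) {c : ℝ} (hc : 0 < c) :
    ∃ n₀ : ℕ, ∀ n : ℕ, n₀ ≤ n →
      ∑ k ∈ Finset.range (n + 1), ∑ i : Fin m, lam ^ (γ * k) * σ i k ^ 2 < c * lam ^ (γ * n) := by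
  have hlam0 : 0 < lam := by linarith
  have hθ1 : lam ^ (-γ) < 1 := Real.rpow_lt_one_of_one_lt_of_neg hlam (by linarith)
  have hθ0 : 0 < 1 - lam ^ (-γ) := by linarith
  -- the tail threshold `ε`, with `m ε² ≤ c (1 - lam^{-γ}) / 4`
  obtain ⟨ε, hε, hε1, hεc⟩ : ∃ ε : ℝ, 0 < ε ∧ ε ≤ 1 ∧ ε ≤ c * (1 - lam ^ (-γ)) / (4 * (m + 1)) :=
    ⟨min 1 (c * (1 - lam ^ (-γ)) / (4 * (m + 1))), lt_min one_pos (by positivity),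
      min_le_left _ _, min_le_right _ _⟩
  have hεc' : ε * (4 * (m + 1)) ≤ c * (1 - lam ^ (-γ)) := (le_div_iff₀ (by positivity)).mp hεc
  have hεsq : ε ^ 2 ≤ ε := by nlinarith
  have hεsq' : 4 * ((m : ℝ) + 1) * ε ^ 2 ≤ 4 * ((m : ℝ) + 1) * ε :=
    mul_le_mul_of_nonneg_left hεsq (by positivity)
  have hmε : (m : ℝ) * ε ^ 2 ≤ c * (1 - lam ^ (-γ)) / 4 := by nlinarith [sq_nonneg ε]
  obtain ⟨k₀, hk₀⟩ := traceEndgame_eventually_small hσ hM hε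
  -- the head `k ≤ k₀` is a constant `H`; `lam^{γn}` outgrows it
  obtain ⟨H, hH⟩ : ∃ H : ℝ, H = ∑ k ∈ Finset.range (k₀ + 1), ∑ i : Fin m, lam ^ (γ * k) * σ i k ^ 2 :=
    ⟨_, rfl⟩
  have hH0 : 0 ≤ H := by
    rw [hH]
    exact Finset.sum_nonneg fun k _ => Finset.sum_nonneg fun i _ => by positivity
  obtain ⟨n₁, hn₁⟩ : ∃ n₁ : ℕ, ∀ n : ℕ, n₁ ≤ n → (2 * H + c) / c ≤ lam ^ (γ * n) := by
    have ht := tendsto_pow_atTop_atTop_of_one_lt (Real.one_lt_rpow hlam hγ)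
    obtain ⟨n₁, hn₁⟩ := Filter.tendsto_atTop_atTop.mp ht ((2 * H + c) / c)
    refine ⟨n₁, fun n hn => ?_⟩
    rw [Real.rpow_mul_natCast hlam0.le]
    exact hn₁ n hn
  refine ⟨max k₀ n₁, fun n hn => ?_⟩
  have hk₀n : k₀ ≤ n := le_trans (le_max_left _ _) hn
  have hn₁n : n₁ ≤ n := le_trans (le_max_right _ _) hn
  have hL : 2 * H + c ≤ c * lam ^ (γ * n) := by
    have h := hn₁ n hn₁n
    rw [div_le_iff₀ hc] at h
    linarith
  -- split off the head and bound the tail by `m ε² Σ_{k ≤ n} lam^{γk} ≤ (c/4) lam^{γn}`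
  rw [← Finset.sum_range_add_sum_Ico _ (Nat.succ_le_succ hk₀n), ← hH]
  have hG0 : 0 ≤ ∑ k ∈ Finset.range (n + 1), lam ^ (γ * (k : ℝ)) :=
    Finset.sum_nonneg fun k _ => by positivity
  have htail : ∑ k ∈ Finset.Ico (k₀ + 1) (n + 1), ∑ i : Fin m, lam ^ (γ * k) * σ i k ^ 2
      ≤ (m : ℝ) * ε ^ 2 * ∑ k ∈ Finset.range (n + 1), lam ^ (γ * k) := by
    calc ∑ k ∈ Finset.Ico (k₀ + 1) (n + 1), ∑ i : Fin m, lam ^ (γ * k) * σ i k ^ 2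
        ≤ ∑ k ∈ Finset.Ico (k₀ + 1) (n + 1), ∑ _i : Fin m, lam ^ (γ * k) * ε ^ 2 := by
          refine Finset.sum_le_sum fun k hk => Finset.sum_le_sum fun i _ => ?_
          have hk' : k₀ < k := (Finset.mem_Ico.mp hk).1
          exact mul_le_mul_of_nonneg_left (pow_le_pow_left₀ (hσ i k) (hk₀ k hk' i).le 2)
            (by positivity)
      _ = (m : ℝ) * ε ^ 2 * ∑ k ∈ Finset.Ico (k₀ + 1) (n + 1), lam ^ (γ * k) := by
          rw [Finset.mul_sum]
          refine Finset.sum_congr rfl fun k _ => ?_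
          rw [Finset.sum_const, Finset.card_univ, Fintype.card_fin, nsmul_eq_mul]
          ring
      _ ≤ (m : ℝ) * ε ^ 2 * ∑ k ∈ Finset.range (n + 1), lam ^ (γ * k) := by
          refine mul_le_mul_of_nonneg_left ?_ (by positivity)
          apply Finset.sum_le_sum_of_subset_of_nonneg
          · rw [Finset.range_eq_Ico]
            exact Finset.Ico_subset_Ico (Nat.zero_le _) le_rfl
          · intro k _ _
            positivity
  have htail' : ∑ k ∈ Finset.Ico (k₀ + 1) (n + 1), ∑ i : Fin m, lam ^ (γ * k) * σ i k ^ 2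
      ≤ c / 4 * lam ^ (γ * n) := by
    calc ∑ k ∈ Finset.Ico (k₀ + 1) (n + 1), ∑ i : Fin m, lam ^ (γ * k) * σ i k ^ 2
        ≤ (m : ℝ) * ε ^ 2 * ∑ k ∈ Finset.range (n + 1), lam ^ (γ * k) := htail
      _ ≤ c * (1 - lam ^ (-γ)) / 4 * ∑ k ∈ Finset.range (n + 1), lam ^ (γ * k) :=
          mul_le_mul_of_nonneg_right hmε hG0
      _ = c / 4 * ((1 - lam ^ (-γ)) * ∑ k ∈ Finset.range (n + 1), lam ^ (γ * k)) := by ring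
      _ ≤ c / 4 * lam ^ (γ * n) :=
          mul_le_mul_of_nonneg_left (traceEndgame_geom hlam0 γ n) (by positivity)
  linarith

/-! ## The lower bound at a front, read at `T⁻` -/

/-- FRONT ⇒ TRACE MASS. If the tilted low-block energies `L^β_N = Σ_{k≤N} Σ_i lam^{2βk} X_{i,k}²` obey
`e^{-Γ lam^{4N/5}(t₂-t₁)} L^β_N(t₁) ≤ L^β_N(t₂)` for `0 < t₁ ≤ t₂ < T` and every `X_{i,n}` tends to
`τ_{i,n}` at `T⁻`, then a `δ`-hot mode `(i,n)` at a time `t ∈ (0,T)` with `lam^{4n/5}(T-t) ≤ R` forces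
`e^{-Γ⁺R⁺} δ² lam^{(2β-2/5)n} ≤ Σ_{k≤n} Σ_i lam^{2βk} τ_{i,k}²` (Grönwall from `t` to `t₂ ∈ [t,T)` costs
at most `e^{-Γ⁺R⁺}`; keep the single term `k = n`; let `t₂ ↑ T`). -/
theorem traceEndgame_front_bound {lam : ℝ} (hlam : 1 < lam) (β : ℝ) {m : ℕ} (Γ : ℝ) {δ : ℝ}
    (R T : ℝ) (X : Fin m → ℤ → ℝ → ℝ) (τ : Fin m → ℤ → ℝ) (hδ : 0 < δ)
    (hG : ∀ (N : ℕ) (t₁ t₂ : ℝ), 0 < t₁ → t₁ ≤ t₂ → t₂ < T →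
      Real.exp (-(Γ * lam ^ ((4 / 5 : ℝ) * N) * (t₂ - t₁))) *
          (∑ k ∈ Finset.range (N + 1), ∑ i : Fin m, lam ^ (2 * β * k) * (X i k t₁) ^ 2)
        ≤ ∑ k ∈ Finset.range (N + 1), ∑ i : Fin m, lam ^ (2 * β * k) * (X i k t₂) ^ 2)
    (hτ : ∀ (i : Fin m) (n : ℤ), Filter.Tendsto (X i n) (nhdsWithin T (Set.Iio T)) (nhds (τ i n)))
    {n : ℕ} {i : Fin m} {t : ℝ} (ht : t ∈ Set.Ioo 0 T) (hR : lam ^ ((4 / 5 : ℝ) * n) * (T - t) ≤ R)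
    (hhot : δ ≤ lam ^ ((1 / 5 : ℝ) * n) * |X i n t|) :
    Real.exp (-(max Γ 0 * max R 0)) * δ ^ 2 * lam ^ ((2 * β - 2 / 5) * n)
      ≤ ∑ k ∈ Finset.range (n + 1), ∑ i : Fin m, lam ^ (2 * β * k) * (τ i k) ^ 2 := by
  have hlam0 : 0 < lam := by linarith
  -- finite sums pass to the limit at `T⁻`
  have hlim : Filter.Tendsto
      (fun s : ℝ => ∑ k ∈ Finset.range (n + 1), ∑ j : Fin m, lam ^ (2 * β * k) * (X j k s) ^ 2)
      (nhdsWithin T (Set.Iio T))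
      (nhds (∑ k ∈ Finset.range (n + 1), ∑ j : Fin m, lam ^ (2 * β * k) * (τ j k) ^ 2)) := by
    refine tendsto_finsetSum _ fun k _ => tendsto_finsetSum _ fun j _ => ?_
    exact ((hτ j k).pow 2).const_mul _
  -- the single hot term at time `t`
  have hlowt : δ ^ 2 * lam ^ ((2 * β - 2 / 5) * n)
      ≤ ∑ k ∈ Finset.range (n + 1), ∑ j : Fin m, lam ^ (2 * β * k) * (X j k t) ^ 2 := by
    have h1 : δ ^ 2 * lam ^ ((2 * β - 2 / 5) * n) ≤ lam ^ (2 * β * (n : ℝ)) * (X i n t) ^ 2 := by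
      rw [traceEndgame_tilt_split hlam0 β (n : ℝ) (X i n t)]
      calc δ ^ 2 * lam ^ ((2 * β - 2 / 5) * n) = lam ^ ((2 * β - 2 / 5) * n) * δ ^ 2 := mul_comm _ _
        _ ≤ lam ^ ((2 * β - 2 / 5) * n) * (lam ^ ((1 / 5 : ℝ) * n) * |X i n t|) ^ 2 :=
            mul_le_mul_of_nonneg_left (pow_le_pow_left₀ hδ.le hhot 2)
              (Real.rpow_pos_of_pos hlam0 _).le
    have h2 : lam ^ (2 * β * (n : ℝ)) * (X i n t) ^ 2
        ≤ ∑ j : Fin m, lam ^ (2 * β * (n : ℝ)) * (X j n t) ^ 2 :=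
      Finset.single_le_sum (f := fun j => lam ^ (2 * β * (n : ℝ)) * (X j n t) ^ 2)
        (fun j _ => by positivity) (Finset.mem_univ i)
    have h3 : ∑ j : Fin m, lam ^ (2 * β * (n : ℝ)) * (X j n t) ^ 2
        ≤ ∑ k ∈ Finset.range (n + 1), ∑ j : Fin m, lam ^ (2 * β * k) * (X j k t) ^ 2 :=
      Finset.single_le_sum
        (f := fun k : ℕ => ∑ j : Fin m, lam ^ (2 * β * (k : ℝ)) * (X j k t) ^ 2)
        (fun k _ => Finset.sum_nonneg fun j _ => by positivity) (Finset.self_mem_range_succ n)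
    exact h1.trans (h2.trans h3)
  -- Grönwall from `t` to `s ∈ [t, T)` costs at most `e^{-Γ⁺R⁺}`
  have hev : ∀ᶠ s in nhdsWithin T (Set.Iio T),
      Real.exp (-(max Γ 0 * max R 0)) * δ ^ 2 * lam ^ ((2 * β - 2 / 5) * n)
        ≤ ∑ k ∈ Finset.range (n + 1), ∑ j : Fin m, lam ^ (2 * β * k) * (X j k s) ^ 2 := by
    filter_upwards [Ico_mem_nhdsLT ht.2] with s hs
    have hG' := hG n t s ht.1 hs.1 hs.2
    have hP0 : 0 ≤ lam ^ ((4 / 5 : ℝ) * n) * (s - t) :=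
      mul_nonneg (Real.rpow_pos_of_pos hlam0 _).le (by linarith [hs.1])
    have hPR : lam ^ ((4 / 5 : ℝ) * n) * (s - t) ≤ max R 0 :=
      le_trans (le_trans (mul_le_mul_of_nonneg_left (by linarith [hs.2])
        (Real.rpow_pos_of_pos hlam0 _).le) hR) (le_max_left _ _)
    have hexp : Real.exp (-(max Γ 0 * max R 0))
        ≤ Real.exp (-(Γ * lam ^ ((4 / 5 : ℝ) * n) * (s - t))) := by
      apply Real.exp_le_exp.mpr
      have : Γ * lam ^ ((4 / 5 : ℝ) * n) * (s - t) ≤ max Γ 0 * max R 0 := by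
        rw [mul_assoc]
        nlinarith [mul_nonneg (sub_nonneg.mpr (le_max_left Γ 0)) hP0,
          mul_nonneg (le_max_right Γ 0) (sub_nonneg.mpr hPR)]
      linarith
    calc Real.exp (-(max Γ 0 * max R 0)) * δ ^ 2 * lam ^ ((2 * β - 2 / 5) * n)
        = Real.exp (-(max Γ 0 * max R 0)) * (δ ^ 2 * lam ^ ((2 * β - 2 / 5) * n)) := by ring
      _ ≤ Real.exp (-(Γ * lam ^ ((4 / 5 : ℝ) * n) * (s - t))) *
            ∑ k ∈ Finset.range (n + 1), ∑ j : Fin m, lam ^ (2 * β * k) * (X j k t) ^ 2 :=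
          mul_le_mul hexp hlowt (by positivity) (Real.exp_pos _).le
      _ ≤ _ := hG'
  exact ge_of_tendsto hlim hev

/-! ## The registered stub -/

/-- **S6: the TRACE ENDGAME (tilted Grönwall read at `T⁻` + Toeplitz)** — registered stub
`stub_traceEndgame` of line `tilted-trace-gronwall` for crux `PerpetualPump.CircuitTrace`, verbatim.
Pure real analysis: if functions `X_{i,n}` obey the tilted Grönwall inequality with tilt `β > 1/5` and
some `Γ` on `(0,T)`, have terminal traces `τ` at `T⁻`, and the traces are `ℓ³`-bounded in critical units,
then there are NO paced fronts at level `δ > 0`, pace `R`, along `n → ∞`. Proof: at a front `(n,i,t)`,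
`traceEndgame_front_bound` gives `Σ_{k≤n} Σ_i lam^{(2β-2/5)k} σ_{i,k}² ≥ e^{-Γ⁺R⁺} δ² lam^{(2β-2/5)n}`
(`σ_{i,k} = lam^{k/5}|τ_{i,k}|`, `traceEndgame_tilt_split`), while `traceEndgame_discounted_small` makes
the left side `< e^{-Γ⁺R⁺} δ² lam^{(2β-2/5)n}` at every large scale `n`. (`m = 0`: no front exists.) -/
theorem stub_traceEndgame :
    ∀ lam : ℝ, 1 < lam → ∀ β : ℝ, 1 / 5 < β → ∀ (m : ℕ) (Γ δ R M T : ℝ) (X : Fin m → ℤ → ℝ → ℝ)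
    (τ : Fin m → ℤ → ℝ), 0 < δ →
    (∀ (N : ℕ) (t₁ t₂ : ℝ), 0 < t₁ → t₁ ≤ t₂ → t₂ < T →
      Real.exp (-(Γ * lam ^ ((4 / 5 : ℝ) * N) * (t₂ - t₁))) *
          (∑ k ∈ Finset.range (N + 1), ∑ i : Fin m, lam ^ (2 * β * k) * (X i k t₁) ^ 2)
        ≤ ∑ k ∈ Finset.range (N + 1), ∑ i : Fin m, lam ^ (2 * β * k) * (X i k t₂) ^ 2) →
    (∀ (i : Fin m) (n : ℤ), Filter.Tendsto (X i n) (nhdsWithin T (Set.Iio T)) (nhds (τ i n))) →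
    (∀ s : Finset ℤ, ∑ n ∈ s, ∑ i : Fin m, (lam ^ ((1 / 5 : ℝ) * n) * |τ i n|) ^ 3 ≤ M) →
    ¬ (∀ n₀ : ℕ, ∃ n : ℕ, n₀ ≤ n ∧ ∃ i : Fin m, ∃ t ∈ Set.Ioo 0 T,
        lam ^ ((4 / 5 : ℝ) * n) * (T - t) ≤ R ∧ δ ≤ lam ^ ((1 / 5 : ℝ) * n) * |X i n t|) := by
  intro lam hlam β hβ m Γ δ R M T X τ hδ hG hτ hM hF
  have hlam0 : 0 < lam := by linarith
  have hγ : 0 < 2 * β - 2 / 5 := by linarith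
  have hσ0 : ∀ (i : Fin m) (k : ℤ), 0 ≤ lam ^ ((1 / 5 : ℝ) * k) * |τ i k| :=
    fun i k => mul_nonneg (Real.rpow_pos_of_pos hlam0 _).le (abs_nonneg _)
  have hc : 0 < Real.exp (-(max Γ 0 * max R 0)) * δ ^ 2 := by positivity
  obtain ⟨n₀, hn₀⟩ := traceEndgame_discounted_small hlam hγ
    (σ := fun i k => lam ^ ((1 / 5 : ℝ) * k) * |τ i k|) hσ0 hM hc
  obtain ⟨n, hn, i, t, ht, hR, hhot⟩ := hF n₀
  have hlow := traceEndgame_front_bound hlam β Γ R T X τ hδ hG hτ ht hR hhot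
  have hup : ∑ k ∈ Finset.range (n + 1), ∑ j : Fin m,
      lam ^ ((2 * β - 2 / 5) * k) * (lam ^ ((1 / 5 : ℝ) * ((k : ℤ) : ℝ)) * |τ j k|) ^ 2
        < Real.exp (-(max Γ 0 * max R 0)) * δ ^ 2 * lam ^ ((2 * β - 2 / 5) * n) := hn₀ n hn
  have hEq : ∑ k ∈ Finset.range (n + 1), ∑ j : Fin m, lam ^ (2 * β * k) * (τ j k) ^ 2
      = ∑ k ∈ Finset.range (n + 1), ∑ j : Fin m,
          lam ^ ((2 * β - 2 / 5) * k) * (lam ^ ((1 / 5 : ℝ) * ((k : ℤ) : ℝ)) * |τ j k|) ^ 2 := by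
    refine Finset.sum_congr rfl fun k _ => Finset.sum_congr rfl fun j _ => ?_
    rw [Int.cast_natCast]
    exact traceEndgame_tilt_split hlam0 β (k : ℝ) (τ j k)
  rw [hEq] at hlow
  exact lt_irrefl _ (hup.trans_le hlow)

end Summit.NavierStokesRegularity.NavierStokesRegularity.Theorems.PerpetualPumpCircuitTrace

end
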